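import Summits.NavierStokesRegularity.NavierStokesRegularity.Theorems.LerayQuarterDissipationFiniteDissipationLiouvilleCalmSliceScaling
import Literature.Analysis.FluidPDE.PoincareBall
import Mathlib.Analysis.Calculus.Deriv.Slope
import HarnessLib

/-!
# Route `CalmSliceGate`, crux `AsymmetricFlickerLiouville` (stmt-NavierStokesRegularity-24453):
# the registered stub `stub_unsteadinessPower` — a one-point unsteadiness floor yields a definite
# scale-critical `L²` power of the unsteadiness on the doubled similarity ball

Theorems file of route `CalmSliceGate` (seat ns-lqd-p2 g4, cell ns-idea-3; `--supports` the wall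
crux `AsymmetricFlickerLiouville`; the critic's first lemma P1 for the LINE-2 residue).
Navier–Stokes regularity is NOT proved here; no summit is; the crux itself (how the power is
CONSUMED) stays open.

For a Type-I ancient mild field `w` (KNSS gauge, constant `C`) the UNSTEADINESS at `(t, x)` is
`𝔘 = √(−t)((−t)∂ₜw − ½w − ½(x·∇)w)` (`= ∂ₛU` in similarity variables). By the Navier–Stokes
scaling (`…CalmSliceScaling.unsteadiness_nsRescale`) everything reduces to the slice `t = −1`,
where the class-uniform parabolic regularity of Koch–Nadirashvili–Seregin–Šverák (bounds on
`Dw`, `D²w` and the time-Lipschitz modulus of `Dw`, tree: `exists_norm_iteratedFDeriv_le_of_typeI`,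
`exists_lipschitz_time_of_typeI`) makes the unsteadiness vector `G(y) = ∂ₜw(−1,y) − ½w(−1,y) −
½Dw(−1)(y)[y]` LIPSCHITZ on every ball with a constant depending only on `C` and the radius
(`exists_lipschitz_unsteadiness`; the time derivative is handled through difference quotients and
the mean value inequality). Hence a floor `‖G(y₀)‖ > δ` at some `‖y₀‖ < R` persists as `‖G‖ > δ/2`
on a ball of class-uniform radius inside `B(0, 2R)` (`exists_power_of_floor`), and scaling back
gives the stub: `∫_{B(0,2R√(−t))} ‖𝔘(t,x)‖² dx ≥ c(C,δ,R) (−t)^{3/2}`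
(`stub_unsteadinessPower`, VERBATIM the registered signature).
-/

noncomputable section

-- the summit and its single sub-problem share the name (CONVENTIONS §1), as in every Theorems file
set_option linter.dupNamespace false

namespace Summit.NavierStokesRegularity.NavierStokesRegularity.Theorems.AsymmetricFlickerLiouville.Birth

open MeasureTheory Set Filter Topology Metric Function
open Literature.Analysis Literature.Analysis.FluidPDE Literature.Analysis.UnboundedOperators
open scoped ENNReal NNReal

/-! ### Class-uniform bounds on the slice `t = −1` -/

/-- Class-uniform bound on `‖Dw(−1)‖` (KNSS 2009, (4.10), tree `exists_norm_iteratedFDeriv_le_of_typeI`).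
[cite: KochNadirashviliSereginSverak2009, §4 (4.10) (arXiv:0709.3599 p. 8)] -/
theorem exists_bound_fderiv_slice (C : ℝ) :
    ∃ K₁ : ℝ, 0 ≤ K₁ ∧ ∀ ⦃w : ℝ → EuclideanSpace ℝ (Fin 3) → EuclideanSpace ℝ (Fin 3)⦄,
      IsTypeIAncientMild C w → ∀ y, ‖fderiv ℝ (w (-1)) y‖ ≤ K₁ := by
  obtain ⟨K, hK⟩ := exists_norm_iteratedFDeriv_le_of_typeI C 1 (a := -2) (b := -1 / 2)
    (δ := 1 / 2) (by norm_num) (by norm_num) (by norm_num)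
  refine ⟨max K 0, le_max_right _ _, fun w hw y => ?_⟩
  have h := hK hw.continuousOn_uncurry (fun t ht => hw.isWeaklyDivFree ht)
    (fun s t hst ht x => hw.mild_eq_heatExtension hst ht x) hw.hasTypeITimeDecay (-1)
    ⟨by norm_num, by norm_num⟩ y
  rw [← norm_iteratedFDeriv_fderiv, norm_iteratedFDeriv_zero] at h
  exact h.trans (le_max_left _ _)

/-- Class-uniform bound on `‖D²w(−1)‖` (KNSS 2009, (4.10)). [cite: KochNadirashviliSereginSverak2009, §4 (4.10) (arXiv:0709.3599 p. 8)] -/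
theorem exists_bound_fderiv_fderiv_slice (C : ℝ) :
    ∃ K₂ : ℝ, 0 ≤ K₂ ∧ ∀ ⦃w : ℝ → EuclideanSpace ℝ (Fin 3) → EuclideanSpace ℝ (Fin 3)⦄,
      IsTypeIAncientMild C w → ∀ y, ‖fderiv ℝ (fderiv ℝ (w (-1))) y‖ ≤ K₂ := by
  obtain ⟨K, hK⟩ := exists_norm_iteratedFDeriv_le_of_typeI C 2 (a := -2) (b := -1 / 2)
    (δ := 1 / 2) (by norm_num) (by norm_num) (by norm_num)
  refine ⟨max K 0, le_max_right _ _, fun w hw y => ?_⟩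
  have h := hK hw.continuousOn_uncurry (fun t ht => hw.isWeaklyDivFree ht)
    (fun s t hst ht x => hw.mild_eq_heatExtension hst ht x) hw.hasTypeITimeDecay (-1)
    ⟨by norm_num, by norm_num⟩ y
  rw [← norm_iteratedFDeriv_fderiv, ← norm_iteratedFDeriv_fderiv, norm_iteratedFDeriv_zero] at h
  exact h.trans (le_max_left _ _)

/-- **Class-uniform spatial Lipschitz bound for the time derivative at `t = −1`** (from the
time-Lipschitz modulus of `Dw`, KNSS 2009 (4.11), tree `exists_lipschitz_time_of_typeI`, through
the mean value inequality for `y ↦ w(t,y) − w(−1,y)` and the limit of difference quotients).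
[cite: KochNadirashviliSereginSverak2009, §4 (4.11) (arXiv:0709.3599 p. 8)] -/
theorem exists_lipschitz_deriv_time (C : ℝ) :
    ∃ L : ℝ, 0 ≤ L ∧ ∀ ⦃w : ℝ → EuclideanSpace ℝ (Fin 3) → EuclideanSpace ℝ (Fin 3)⦄,
      IsTypeIAncientMild C w → ∀ y y' : EuclideanSpace ℝ (Fin 3),
        ‖deriv (fun τ => w τ y) (-1) - deriv (fun τ => w τ y') (-1)‖ ≤ L * ‖y - y'‖ := by
  obtain ⟨L, hL0, hL⟩ := exists_lipschitz_time_of_typeI C 1 (a := -2) (b := -1 / 2)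
    (δ := 1 / 2) (by norm_num) (by norm_num) (by norm_num)
  refine ⟨L, hL0, fun w hw y y' => ?_⟩
  -- the difference quotients
  set f : ℝ → EuclideanSpace ℝ (Fin 3) := fun τ => w τ y with hf
  set f' : ℝ → EuclideanSpace ℝ (Fin 3) := fun τ => w τ y' with hf'
  have hdy := (FiniteDissipationLiouville.CalmSlice.differentiableAt_time hw (by norm_num : (-1 : ℝ) < 0) y).hasDerivAt
  have hdy' := (FiniteDissipationLiouville.CalmSlice.differentiableAt_time hw (by norm_num : (-1 : ℝ) < 0) y').hasDerivAt
  have hty : Tendsto (slope f (-1)) (𝓝[≠] (-1)) (𝓝 (deriv f (-1))) := hdy.tendsto_slope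
  have hty' : Tendsto (slope f' (-1)) (𝓝[≠] (-1)) (𝓝 (deriv f' (-1))) := hdy'.tendsto_slope
  have hlim : Tendsto (fun t => ‖slope f (-1) t - slope f' (-1) t‖) (𝓝[≠] (-1))
      (𝓝 ‖deriv f (-1) - deriv f' (-1)‖) := (hty.sub hty').norm
  -- the uniform bound on the quotients near `-1`
  have hbound : ∀ᶠ t in 𝓝[≠] (-1 : ℝ), ‖slope f (-1) t - slope f' (-1) t‖ ≤ L * ‖y - y'‖ := by
    have hnhds : Ioo (-3 / 2 : ℝ) (-1 / 2) ∈ 𝓝[≠] (-1 : ℝ) :=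
      mem_nhdsWithin_of_mem_nhds (Ioo_mem_nhds (by norm_num) (by norm_num))
    filter_upwards [hnhds, self_mem_nhdsWithin] with t ht hne
    have hne' : t ≠ -1 := hne
    have htI : t ∈ Ico (-2 + 1 / 2 : ℝ) (-1 / 2) := ⟨by linarith [ht.1], ht.2⟩
    have h1I : (-1 : ℝ) ∈ Ico (-2 + 1 / 2 : ℝ) (-1 / 2) := ⟨by norm_num, by norm_num⟩
    have ht0 : t < 0 := by linarith [ht.2]
    -- the spatial map `Φ y = w t y - w (-1) y` is `L|t+1|`-Lipschitz
    set Φ : EuclideanSpace ℝ (Fin 3) → EuclideanSpace ℝ (Fin 3) := fun z => w t z - w (-1) z with hΦ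
    have hct : ContDiff ℝ 1 (w t) := (hw.contDiff_slice ht0).of_le (by exact_mod_cast le_top)
    have hc1 : ContDiff ℝ 1 (w (-1)) :=
      (hw.contDiff_slice (by norm_num)).of_le (by exact_mod_cast le_top)
    have hΦd : ∀ z, DifferentiableAt ℝ Φ z := fun z =>
      ((hct.differentiable one_ne_zero) z).sub ((hc1.differentiable one_ne_zero) z)
    have hΦb : ∀ z, ‖fderiv ℝ Φ z‖ ≤ L * |t - (-1)| := by
      intro z
      have e1 : fderiv ℝ Φ z = fderiv ℝ (w t - w (-1)) z := rfl
      have e2 : ‖fderiv ℝ (w t - w (-1)) z‖ = ‖iteratedFDeriv ℝ 1 (w t - w (-1)) z‖ := by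
        rw [← norm_iteratedFDeriv_fderiv, norm_iteratedFDeriv_zero]
      rw [e1, e2, iteratedFDeriv_sub_apply ((hw.contDiff_slice ht0).contDiffAt.of_le
        (by exact_mod_cast le_top)) ((hw.contDiff_slice (by norm_num)).contDiffAt.of_le
        (by exact_mod_cast le_top))]
      exact hL hw.continuousOn_uncurry (fun t ht => hw.isWeaklyDivFree ht)
        (fun s t hst ht x => hw.mild_eq_heatExtension hst ht x) hw.hasTypeITimeDecay
        (-1) h1I t htI z
    have hmv : ‖Φ y - Φ y'‖ ≤ L * |t - (-1)| * ‖y - y'‖ :=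
      (convex_univ (𝕜 := ℝ) (E := EuclideanSpace ℝ (Fin 3))).norm_image_sub_le_of_norm_fderiv_le
        (fun z _ => hΦd z) (fun z _ => hΦb z) (mem_univ y') (mem_univ y)
    -- divide by `|t + 1|`
    have hpos : 0 < |t - (-1)| := abs_pos.2 (sub_ne_zero.2 hne')
    have e : slope f (-1) t - slope f' (-1) t = (t - (-1))⁻¹ • (Φ y - Φ y') := by
      rw [slope_def_module, slope_def_module, ← smul_sub]
    rw [e, norm_smul, norm_inv, Real.norm_eq_abs]
    rw [inv_mul_le_iff₀ hpos]
    calc ‖Φ y - Φ y'‖ ≤ L * |t - (-1)| * ‖y - y'‖ := hmv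
      _ = |t - (-1)| * (L * ‖y - y'‖) := by ring
  exact le_of_tendsto hlim hbound

/-- **The unsteadiness vector at `t = −1` is Lipschitz on balls, uniformly over the class**:
for `‖y‖, ‖y'‖ ≤ ρ₀`,
`‖G(y) − G(y')‖ ≤ Λ(C, ρ₀) ‖y − y'‖`, `G(y) = ∂ₜw(−1,y) − ½w(−1,y) − ½Dw(−1)(y)[y]`.
[cite: KochNadirashviliSereginSverak2009, §4 (4.10)–(4.11) (arXiv:0709.3599 p. 8)] -/
theorem exists_lipschitz_unsteadiness (C ρ₀ : ℝ) (hρ₀ : 0 ≤ ρ₀) :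
    ∃ Λ : ℝ, 0 ≤ Λ ∧ ∀ ⦃w : ℝ → EuclideanSpace ℝ (Fin 3) → EuclideanSpace ℝ (Fin 3)⦄,
      IsTypeIAncientMild C w → ∀ y ∈ closedBall (0 : EuclideanSpace ℝ (Fin 3)) ρ₀,
        ∀ y' ∈ closedBall (0 : EuclideanSpace ℝ (Fin 3)) ρ₀,
        ‖(deriv (fun τ => w τ y) (-1) - (1 / 2 : ℝ) • w (-1) y - (1 / 2 : ℝ) • fderiv ℝ (w (-1)) y y) -
          (deriv (fun τ => w τ y') (-1) - (1 / 2 : ℝ) • w (-1) y' -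
            (1 / 2 : ℝ) • fderiv ℝ (w (-1)) y' y')‖ ≤ Λ * ‖y - y'‖ := by
  obtain ⟨K₁, hK₁0, hK₁⟩ := exists_bound_fderiv_slice C
  obtain ⟨K₂, hK₂0, hK₂⟩ := exists_bound_fderiv_fderiv_slice C
  obtain ⟨L, hL0, hL⟩ := exists_lipschitz_deriv_time C
  refine ⟨L + K₁ / 2 + (ρ₀ * K₂ + K₁) / 2, by positivity, fun w hw y hy y' hy' => ?_⟩
  have hc : ContDiff ℝ (⊤ : ℕ∞) (w (-1)) := hw.contDiff_slice (by norm_num)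
  -- the three pieces
  have h1 := hL hw y y'
  have h2 : ‖w (-1) y - w (-1) y'‖ ≤ K₁ * ‖y - y'‖ :=
    (convex_univ (𝕜 := ℝ) (E := EuclideanSpace ℝ (Fin 3))).norm_image_sub_le_of_norm_fderiv_le
      (fun z _ => (hc.differentiable (by simp)) z) (fun z _ => hK₁ hw z) (mem_univ y') (mem_univ y)
  have h3a : ‖fderiv ℝ (w (-1)) y - fderiv ℝ (w (-1)) y'‖ ≤ K₂ * ‖y - y'‖ := by
    have hd : ∀ z, DifferentiableAt ℝ (fderiv ℝ (w (-1))) z := fun z =>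
      ((hc.fderiv_right (m := 1) (by norm_cast)).differentiable one_ne_zero) z
    exact (convex_univ (𝕜 := ℝ) (E := EuclideanSpace ℝ (Fin 3))).norm_image_sub_le_of_norm_fderiv_le
      (fun z _ => hd z) (fun z _ => hK₂ hw z) (mem_univ y') (mem_univ y)
  have h3 : ‖fderiv ℝ (w (-1)) y y - fderiv ℝ (w (-1)) y' y'‖ ≤ (ρ₀ * K₂ + K₁) * ‖y - y'‖ := by
    have e : fderiv ℝ (w (-1)) y y - fderiv ℝ (w (-1)) y' y' =
        (fderiv ℝ (w (-1)) y y - fderiv ℝ (w (-1)) y' y) + fderiv ℝ (w (-1)) y' (y - y') := by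
      rw [map_sub]; abel
    rw [e]
    have hyn : ‖y‖ ≤ ρ₀ := mem_closedBall_zero_iff.1 hy
    have hA : ‖fderiv ℝ (w (-1)) y y - fderiv ℝ (w (-1)) y' y‖ ≤
        ‖fderiv ℝ (w (-1)) y - fderiv ℝ (w (-1)) y'‖ * ‖y‖ :=
      (fderiv ℝ (w (-1)) y - fderiv ℝ (w (-1)) y').le_opNorm y
    have hB : ‖fderiv ℝ (w (-1)) y' (y - y')‖ ≤ ‖fderiv ℝ (w (-1)) y'‖ * ‖y - y'‖ :=
      (fderiv ℝ (w (-1)) y').le_opNorm (y - y')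
    have hA' : ‖fderiv ℝ (w (-1)) y - fderiv ℝ (w (-1)) y'‖ * ‖y‖ ≤ K₂ * ‖y - y'‖ * ρ₀ :=
      mul_le_mul h3a hyn (norm_nonneg _) (mul_nonneg hK₂0 (norm_nonneg _))
    have hB' : ‖fderiv ℝ (w (-1)) y'‖ * ‖y - y'‖ ≤ K₁ * ‖y - y'‖ :=
      mul_le_mul_of_nonneg_right (hK₁ hw y') (norm_nonneg _)
    calc ‖(fderiv ℝ (w (-1)) y y - fderiv ℝ (w (-1)) y' y) + fderiv ℝ (w (-1)) y' (y - y')‖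
        ≤ ‖fderiv ℝ (w (-1)) y y - fderiv ℝ (w (-1)) y' y‖ + ‖fderiv ℝ (w (-1)) y' (y - y')‖ :=
          norm_add_le _ _
      _ ≤ K₂ * ‖y - y'‖ * ρ₀ + K₁ * ‖y - y'‖ := add_le_add (hA.trans hA') (hB.trans hB')
      _ = (ρ₀ * K₂ + K₁) * ‖y - y'‖ := by ring
  -- assemble
  have e : (deriv (fun τ => w τ y) (-1) - (1 / 2 : ℝ) • w (-1) y - (1 / 2 : ℝ) • fderiv ℝ (w (-1)) y y) -
      (deriv (fun τ => w τ y') (-1) - (1 / 2 : ℝ) • w (-1) y' - (1 / 2 : ℝ) • fderiv ℝ (w (-1)) y' y') =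
      (deriv (fun τ => w τ y) (-1) - deriv (fun τ => w τ y') (-1)) -
        (1 / 2 : ℝ) • (w (-1) y - w (-1) y') -
        (1 / 2 : ℝ) • (fderiv ℝ (w (-1)) y y - fderiv ℝ (w (-1)) y' y') := by
    simp only [smul_sub]; abel
  rw [e]
  calc ‖(deriv (fun τ => w τ y) (-1) - deriv (fun τ => w τ y') (-1)) -
        (1 / 2 : ℝ) • (w (-1) y - w (-1) y') -
        (1 / 2 : ℝ) • (fderiv ℝ (w (-1)) y y - fderiv ℝ (w (-1)) y' y')‖
      ≤ ‖deriv (fun τ => w τ y) (-1) - deriv (fun τ => w τ y') (-1)‖ +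
          ‖(1 / 2 : ℝ) • (w (-1) y - w (-1) y')‖ +
          ‖(1 / 2 : ℝ) • (fderiv ℝ (w (-1)) y y - fderiv ℝ (w (-1)) y' y')‖ :=
        (norm_sub_le _ _).trans (add_le_add (norm_sub_le _ _) le_rfl)
    _ ≤ L * ‖y - y'‖ + (1 / 2) * (K₁ * ‖y - y'‖) + (1 / 2) * ((ρ₀ * K₂ + K₁) * ‖y - y'‖) := by
        rw [norm_smul, norm_smul, Real.norm_of_nonneg (by norm_num : (0 : ℝ) ≤ 1 / 2)]
        gcongr
    _ = (L + K₁ / 2 + (ρ₀ * K₂ + K₁) / 2) * ‖y - y'‖ := by ring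

/-! ### One-point floor ⇒ definite `L²` power at `t = −1` -/

/-- **A one-point floor of the unsteadiness at `t = −1` gives a definite `L²` power on the doubled
ball**, uniformly over the class: there is `c = c(C, δ, R) > 0` with
`∫_{B(0,2R)} ‖G‖² ≥ c` whenever `‖G(y₀)‖ > δ` at some `‖y₀‖ < R` (Lipschitz persistence on a
ball of class-uniform radius). [cite: KochNadirashviliSereginSverak2009, §4 (4.10)–(4.11) (arXiv:0709.3599 p. 8)] -/
theorem exists_power_of_floor (C δ R : ℝ) (hδ : 0 < δ) (hR : 0 < R) :
    ∃ c > 0, ∀ ⦃w : ℝ → EuclideanSpace ℝ (Fin 3) → EuclideanSpace ℝ (Fin 3)⦄,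
      IsTypeIAncientMild C w →
      (∃ y ∈ ball (0 : EuclideanSpace ℝ (Fin 3)) R,
        δ < ‖deriv (fun τ => w τ y) (-1) - (1 / 2 : ℝ) • w (-1) y - (1 / 2 : ℝ) • fderiv ℝ (w (-1)) y y‖) →
      ENNReal.ofReal c ≤ ∫⁻ y in ball (0 : EuclideanSpace ℝ (Fin 3)) (2 * R),
        ‖deriv (fun τ => w τ y) (-1) - (1 / 2 : ℝ) • w (-1) y -
          (1 / 2 : ℝ) • fderiv ℝ (w (-1)) y y‖ₑ ^ 2 := by
  obtain ⟨Λ, hΛ0, hΛ⟩ := exists_lipschitz_unsteadiness C (2 * R) (by positivity)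
  set ρ : ℝ := min R (δ / (2 * (Λ + 1))) with hρ
  have hρpos : 0 < ρ := lt_min hR (by positivity)
  have hρR : ρ ≤ R := min_le_left _ _
  have hρΛ : Λ * ρ ≤ δ / 2 := by
    have h1 : ρ ≤ δ / (2 * (Λ + 1)) := min_le_right _ _
    have h2 : Λ * ρ ≤ Λ * (δ / (2 * (Λ + 1))) := mul_le_mul_of_nonneg_left h1 hΛ0
    have h3 : Λ * (δ / (2 * (Λ + 1))) ≤ δ / 2 := by
      rw [mul_div_assoc', div_le_div_iff₀ (by positivity) (by positivity)]
      nlinarith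
    linarith
  have hvol : 0 < volume (ball (0 : EuclideanSpace ℝ (Fin 3)) ρ) := measure_ball_pos _ _ hρpos
  have hvol' : volume (ball (0 : EuclideanSpace ℝ (Fin 3)) ρ) < ⊤ := measure_ball_lt_top
  refine ⟨(δ / 2) ^ 2 * (volume (ball (0 : EuclideanSpace ℝ (Fin 3)) ρ)).toReal,
    mul_pos (by positivity) (ENNReal.toReal_pos hvol.ne' hvol'.ne), fun w hw ⟨y₀, hy₀, hfloor⟩ => ?_⟩
  have hy₀n : ‖y₀‖ < R := mem_ball_zero_iff.1 hy₀
  -- on `ball y₀ ρ ⊆ ball 0 (2R)` the unsteadiness exceeds `δ/2`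
  have hsub : ball y₀ ρ ⊆ ball (0 : EuclideanSpace ℝ (Fin 3)) (2 * R) := by
    intro y hy
    rw [mem_ball_zero_iff]
    have h1 : ‖y - y₀‖ < ρ := mem_ball_iff_norm.1 hy
    have h2 : ‖y‖ ≤ ‖y - y₀‖ + ‖y₀‖ := norm_le_norm_sub_add y y₀
    linarith
  have hbig : ∀ y ∈ ball y₀ ρ, ENNReal.ofReal ((δ / 2) ^ 2) ≤
      ‖deriv (fun τ => w τ y) (-1) - (1 / 2 : ℝ) • w (-1) y -
        (1 / 2 : ℝ) • fderiv ℝ (w (-1)) y y‖ₑ ^ 2 := by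
    intro y hy
    have hy2 : y ∈ closedBall (0 : EuclideanSpace ℝ (Fin 3)) (2 * R) :=
      ball_subset_closedBall (hsub hy)
    have hy₀2 : y₀ ∈ closedBall (0 : EuclideanSpace ℝ (Fin 3)) (2 * R) :=
      mem_closedBall_zero_iff.2 (by linarith)
    have hdist : ‖y - y₀‖ < ρ := mem_ball_iff_norm.1 hy
    have hge : δ / 2 ≤ ‖deriv (fun τ => w τ y) (-1) - (1 / 2 : ℝ) • w (-1) y -
        (1 / 2 : ℝ) • fderiv ℝ (w (-1)) y y‖ := by
      have htri := norm_le_norm_add_norm_sub'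
        (deriv (fun τ => w τ y₀) (-1) - (1 / 2 : ℝ) • w (-1) y₀ - (1 / 2 : ℝ) • fderiv ℝ (w (-1)) y₀ y₀)
        (deriv (fun τ => w τ y) (-1) - (1 / 2 : ℝ) • w (-1) y - (1 / 2 : ℝ) • fderiv ℝ (w (-1)) y y)
      have hlip' := hΛ hw y₀ hy₀2 y hy2
      rw [norm_sub_rev y₀ y] at hlip'
      have hΛd : Λ * ‖y - y₀‖ ≤ δ / 2 :=
        (mul_le_mul_of_nonneg_left hdist.le hΛ0).trans hρΛ
      linarith
    rw [← ofReal_norm, ← ENNReal.ofReal_pow (norm_nonneg _)]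
    exact ENNReal.ofReal_le_ofReal (pow_le_pow_left₀ (by positivity) hge 2)
  -- integrate over the small ball
  calc ENNReal.ofReal ((δ / 2) ^ 2 * (volume (ball (0 : EuclideanSpace ℝ (Fin 3)) ρ)).toReal)
      = ENNReal.ofReal ((δ / 2) ^ 2) * volume (ball y₀ ρ) := by
        rw [ENNReal.ofReal_mul (by positivity), ENNReal.ofReal_toReal hvol'.ne,
          Measure.addHaar_ball_center volume y₀ ρ]
    _ = ∫⁻ _ in ball y₀ ρ, ENNReal.ofReal ((δ / 2) ^ 2) := by
        rw [setLIntegral_const]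
    _ ≤ ∫⁻ y in ball y₀ ρ, ‖deriv (fun τ => w τ y) (-1) - (1 / 2 : ℝ) • w (-1) y -
          (1 / 2 : ℝ) • fderiv ℝ (w (-1)) y y‖ₑ ^ 2 :=
        setLIntegral_mono' measurableSet_ball hbig
    _ ≤ ∫⁻ y in ball (0 : EuclideanSpace ℝ (Fin 3)) (2 * R), ‖deriv (fun τ => w τ y) (-1) -
          (1 / 2 : ℝ) • w (-1) y - (1 / 2 : ℝ) • fderiv ℝ (w (-1)) y y‖ₑ ^ 2 :=
        lintegral_mono_set hsub

/-! ### Scaling back: the stub -/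

/-- **`stub_unsteadinessPower`** (registered stub of `AsymmetricFlickerLiouville`, critic P1 first
lemma): there is `c = c(C, δ, R) > 0` such that for every Type-I ancient mild field `w` (constant
`C`) and every `t < 0`, a one-point floor `‖𝔘(t, x₀)‖ > δ` of the unsteadiness at some
`‖x₀‖ < R√(−t)` forces the scale-critical power `∫_{B(0, 2R√(−t))} ‖𝔘(t, x)‖² dx ≥ c (−t)^{3/2}`
(rescale to `t = −1` by `nsRescale √(−t)`, where the unsteadiness is scale invariant and Lipschitz
with a class-uniform constant; change variables `x = √(−t) y`). [cite: KochNadirashviliSereginSverak2009, §4 (4.10)–(4.11) (arXiv:0709.3599 p. 8)] -/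
theorem stub_unsteadinessPower (C δ R : ℝ) (hδ : 0 < δ) (hR : 0 < R) :
    ∃ c > 0, ∀ w : ℝ → EuclideanSpace ℝ (Fin 3) → EuclideanSpace ℝ (Fin 3),
      IsTypeIAncientMild C w → ∀ t < 0,
        (∃ x ∈ Metric.ball (0 : EuclideanSpace ℝ (Fin 3)) (R * Real.sqrt (-t)),
          δ < ‖Real.sqrt (-t) • ((-t) • deriv (fun τ => w τ x) t - (1 / 2 : ℝ) • w t x -
            (1 / 2 : ℝ) • fderiv ℝ (w t) x x)‖) →
        ENNReal.ofReal (c * (-t) ^ (3 / 2 : ℝ)) ≤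
          ∫⁻ x in Metric.ball (0 : EuclideanSpace ℝ (Fin 3)) (2 * R * Real.sqrt (-t)),
            ‖Real.sqrt (-t) • ((-t) • deriv (fun τ => w τ x) t - (1 / 2 : ℝ) • w t x -
              (1 / 2 : ℝ) • fderiv ℝ (w t) x x)‖ₑ ^ 2 := by
  obtain ⟨c, hc, hpow⟩ := exists_power_of_floor C δ R hδ hR
  refine ⟨c, hc, fun w hw t ht hfloor => ?_⟩
  set μ : ℝ := Real.sqrt (-t) with hμ
  have hμpos : 0 < μ := Real.sqrt_pos.2 (neg_pos.2 ht)
  have hμne : μ ≠ 0 := hμpos.ne'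
  set v : ℝ → EuclideanSpace ℝ (Fin 3) → EuclideanSpace ℝ (Fin 3) := nsRescale μ w with hv
  have hvcl : IsTypeIAncientMild C v := isTypeIAncientMild_nsRescale hw hμpos
  -- the unsteadiness of `w` at `(t, x)` is that of `v` at `(-1, μ⁻¹ x)`
  have hE : ∀ x : EuclideanSpace ℝ (Fin 3),
      Real.sqrt (-t) • ((-t) • deriv (fun τ => w τ x) t - (1 / 2 : ℝ) • w t x -
        (1 / 2 : ℝ) • fderiv ℝ (w t) x x) =
      deriv (fun τ => v τ (μ⁻¹ • x)) (-1) - (1 / 2 : ℝ) • v (-1) (μ⁻¹ • x) -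
        (1 / 2 : ℝ) • fderiv ℝ (v (-1)) (μ⁻¹ • x) (μ⁻¹ • x) := by
    intro x
    have h := FiniteDissipationLiouville.CalmSlice.unsteadiness_nsRescale hw ht (μ⁻¹ • x)
    rw [← hμ, smul_smul, mul_inv_cancel₀ hμne, one_smul] at h
    rw [hv, h]
  -- the floor transfers to `t = -1`
  have hfloor' : ∃ y ∈ ball (0 : EuclideanSpace ℝ (Fin 3)) R,
      δ < ‖deriv (fun τ => v τ y) (-1) - (1 / 2 : ℝ) • v (-1) y - (1 / 2 : ℝ) • fderiv ℝ (v (-1)) y y‖ := by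
    obtain ⟨x, hx, hδx⟩ := hfloor
    refine ⟨μ⁻¹ • x, ?_, by rwa [← hE x]⟩
    rw [mem_ball_zero_iff] at hx ⊢
    rw [norm_smul, norm_inv, Real.norm_of_nonneg hμpos.le, inv_mul_lt_iff₀ hμpos]
    linarith [mul_comm R μ]
  have hP := hpow hvcl hfloor'
  -- change of variables `x = μ y` in the power integral
  set Gsq : EuclideanSpace ℝ (Fin 3) → ℝ≥0∞ := fun y =>
    ‖deriv (fun τ => v τ y) (-1) - (1 / 2 : ℝ) • v (-1) y - (1 / 2 : ℝ) • fderiv ℝ (v (-1)) y y‖ₑ ^ 2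
    with hGsq
  have hset : ∀ x : EuclideanSpace ℝ (Fin 3),
      x ∈ ball (0 : EuclideanSpace ℝ (Fin 3)) (2 * R * μ) ↔
        μ⁻¹ • x ∈ ball (0 : EuclideanSpace ℝ (Fin 3)) (2 * R) := by
    intro x
    rw [mem_ball_zero_iff, mem_ball_zero_iff, norm_smul, norm_inv, Real.norm_of_nonneg hμpos.le,
      inv_mul_lt_iff₀ hμpos]
    constructor <;> intro h <;> linarith [mul_comm (2 * R) μ]
  have hcv : ∫⁻ x in ball (0 : EuclideanSpace ℝ (Fin 3)) (2 * R * μ),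
      ‖Real.sqrt (-t) • ((-t) • deriv (fun τ => w τ x) t - (1 / 2 : ℝ) • w t x -
        (1 / 2 : ℝ) • fderiv ℝ (w t) x x)‖ₑ ^ 2 =
      ENNReal.ofReal (μ ^ 3) * ∫⁻ y in ball (0 : EuclideanSpace ℝ (Fin 3)) (2 * R), Gsq y := by
    rw [← lintegral_indicator measurableSet_ball, ← lintegral_indicator measurableSet_ball]
    have e : (ball (0 : EuclideanSpace ℝ (Fin 3)) (2 * R * μ)).indicator (fun x =>
        ‖Real.sqrt (-t) • ((-t) • deriv (fun τ => w τ x) t - (1 / 2 : ℝ) • w t x -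
          (1 / 2 : ℝ) • fderiv ℝ (w t) x x)‖ₑ ^ 2) =
        fun x => (ball (0 : EuclideanSpace ℝ (Fin 3)) (2 * R)).indicator Gsq (μ⁻¹ • x + 0) := by
      funext x
      rw [add_zero]
      by_cases hx : x ∈ ball (0 : EuclideanSpace ℝ (Fin 3)) (2 * R * μ)
      · rw [indicator_of_mem hx, indicator_of_mem ((hset x).1 hx), hGsq, hE x]
      · rw [indicator_of_notMem hx, indicator_of_notMem (fun h => hx ((hset x).2 h))]
    rw [e, PoincareBall.lintegral_comp_smul_add _ (inv_ne_zero hμne) 0, finrank_euclideanSpace_fin]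
    congr 1
    rw [inv_pow, inv_inv, abs_of_pos (pow_pos hμpos 3)]
  have hμ3 : μ ^ 3 = (-t) ^ (3 / 2 : ℝ) := by
    rw [hμ, Real.sqrt_eq_rpow, ← Real.rpow_natCast, ← Real.rpow_mul (neg_nonneg.2 ht.le)]
    norm_num
  rw [hcv, mul_comm c, ENNReal.ofReal_mul (by rw [← hμ3]; positivity), ← hμ3]
  exact mul_le_mul_of_nonneg_left hP bot_le

end Summit.NavierStokesRegularity.NavierStokesRegularity.Theorems.AsymmetricFlickerLiouville.Birth

end
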